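import Mathlib.Analysis.Complex.UpperHalfPlane.Topology
import Mathlib.Analysis.Complex.UpperHalfPlane.MoebiusAction
import Mathlib.Analysis.Calculus.ContDiff.Basic
import Mathlib.Topology.Algebra.ConstMulAction
import Mathlib.GroupTheory.Perm.Basic
import Mathlib.SetTheory.Cardinal.Finite
import HarnessLib

/-!
# Random covers of a compact hyperbolic surface have relative spectral gap `3/16 − ε` (Magee–Naud–Puder)

Topic `Literature/Geometry/Riemannian` (spectral geometry of hyperbolic surfaces), cite item
`wi-33646` (wanted by route `HyperbolicRegulator`, crux `CurvatureAnchor`).  The result is vended as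
a NAMED FACT (`def … : Prop`, D-0014) in the concrete uniformised model the paper itself works in.

## Source

M. Magee, F. Naud, D. Puder, *A random cover of a compact hyperbolic surface has relative spectral
gap `3/16 − ε`*, Geom. Funct. Anal. 32 (2022) 595–661 (doi:10.1007/s00039-022-00602-x,
arXiv:2003.10911v4).  Numbering of the arXiv v4 / published text (checked on the PDF): the main
theorem is **Theorem 1.5** (labelled `thm:three-sixteenths`; the `1/4`-version is Conjecture 1.1 —
the "Thm 1.1" of the request).

* §1.1, the model: "we have a free properly discontinuous action of `Γ_g` on `ℍ` by isometries.
  Define a new action of `Γ_g` on `ℍ × [n]` by `γ(z, i) = (γ z, φ[γ](i))`. The quotient of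
  `ℍ × [n]` by this action is named `X_φ` and is a hyperbolic covering of `X` with monodromy `φ`.
  This construction establishes a one-to-one correspondence between `φ ∈ 𝕏_{g,n} := Hom(Γ_g, Sₙ)`
  and degree-`n` coverings with a labeled fiber `X_φ` of `X`. … We say an eigenvalue of `Δ_{X_φ}`
  is *new* if it is not one of `Δ_X`, or more generally, appears with greater multiplicity in
  `X_φ`. To pick a random cover of `X`, we simply use the uniform probability measure on the finite
  set `𝕏_{g,n}`. Recall we say an event that pertains to any `n` holds a.a.s. if it holds with
  probability tending to one as `n → ∞`."
* **Theorem 1.5.** "Let `X` be a compact connected hyperbolic surface. Then for any `ε > 0`,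
  a.a.s. `spec(Δ_{X_φ}) ∩ [0, 3/16 − ε] = spec(Δ_X) ∩ [0, 3/16 − ε]` and the multiplicities on
  both sides are the same."

## How it is typed

* The surface.  `X = Γ\ℍ` for a subgroup `Γ ≤ SL(2,ℝ)` acting on Mathlib's upper half-plane `ℍ`
  (`UpperHalfPlane.SLAction`, Möbius transformations) **freely** (`γ • z = z → γ = 1`; this forces
  `−I ∉ Γ`, so `Γ` maps isomorphically onto its image in `PSL(2,ℝ)` and `Γ ≅ π₁(X)`), **properly
  discontinuously** (Mathlib `ProperlyDiscontinuousSMul Γ ℍ`) and **cocompactly** (a compact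
  `K ⊆ ℍ` meets every orbit) — `IsCompactHyperbolicSurfaceGroup Γ`.  Every compact connected
  hyperbolic surface is of this form (uniformisation; a Fuchsian surface group lifts from
  `PSL(2,ℝ)` to `SL(2,ℝ)`), and conversely, so the typed fact is the theorem read in the paper's
  own model.
* The covers and their new eigenfunctions.  A degree-`n` cover with labelled fibre is a
  homomorphism `φ : Γ →* Equiv.Perm (Fin n)`; functions on `X_φ` are the functions
  `F : ℍ → ℂⁿ` with `F(γ z) = P(φ γ) F(z)`, `(P σ v)ᵢ = v_{σ⁻¹ i}` (`permAct`; from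
  `g(γ z, φ γ i) = g(z, i)` for `g` on `ℍ × [n]`), and the pull-backs from `X` are those with all
  coordinates equal.  Since `Δ` and the splitting `ℂⁿ = ℂ·𝟙 ⊕ V⁰`, `V⁰ = {∑ᵢ vᵢ = 0}`, commute
  with the `Γ`-action, the `λ`-eigenspace of `Δ_{X_φ}` is (old `λ`-eigenspace of `X`) `⊕` (the
  `V⁰`-valued equivariant `λ`-eigenfunctions), so "`λ` is a new eigenvalue of `X_φ`" is exactly
  "there is a non-zero `V⁰`-valued `φ`-equivariant eigenfunction with eigenvalue `λ`"
  (`HasNewEigenfunction`), and the conclusion of Theorem 1.5 for `φ` is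
  `¬ ∃ λ ∈ [0, 3/16 − ε], HasNewEigenfunction Γ φ λ`.  The Laplacian is the hyperbolic one,
  `Δ = −y² (∂²/∂x² + ∂²/∂y²)`, written with Mathlib's `iteratedFDeriv ℝ 2` on `ℂ ⊇ ℍ`
  (`hyperbolicLaplacian`); eigenfunctions are taken `C²` on the open upper half-plane (on a compact
  quotient every `C²` solution of `Δ F = λ F` is a genuine `L²` eigenfunction and conversely every
  eigenfunction is smooth, so the eigenvalue set is the spectral one).
* "a.a.s.": the proportion `#{φ good} / #Hom(Γ, Sₙ)` (`Nat.card`; `Hom(Γ, Sₙ)` is finite and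
  non-empty, `Γ` being a surface group) tends to `1` along `n → ∞` (`Filter.atTop`).

Typed as a fact only (no proof in reach: the argument is the paper's 60 pages of
representation-theoretic and probabilistic estimates).  Not typed: the density estimate Thm. 1.8,
Conjecture 1.1, and the requester's corollary about towers of covers with systole `→ ∞` (a
consequence to be drawn problem-side).
-/

noncomputable section

open scoped MatrixGroups UpperHalfPlane Topology
open Filter

namespace Literature.Geometry.Riemannian

/-! ### The uniformised model -/

/-- **Compact hyperbolic surface groups** (the paper's standing hypothesis "`X` a compact connected
hyperbolic surface", read through uniformisation `X = Γ\ℍ`): a subgroup `Γ ≤ SL(2,ℝ)` acting on the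
upper half-plane by Möbius transformations freely ("free properly discontinuous action of `Γ_g` on
`ℍ` by isometries"), properly discontinuously, and cocompactly (some compact set meets every orbit,
i.e. `Γ\ℍ` is compact).  Freeness forces `−I ∉ Γ`, so `Γ ≅ π₁(Γ\ℍ)`.
[cite: MageeNaudPuder2022, §1.1] -/
def IsCompactHyperbolicSurfaceGroup (Γ : Subgroup SL(2, ℝ)) : Prop :=
  ProperlyDiscontinuousSMul Γ ℍ ∧
    (∀ γ : Γ, ∀ z : ℍ, γ • z = z → γ = 1) ∧
      ∃ K : Set ℍ, IsCompact K ∧ ∀ z : ℍ, ∃ γ : Γ, γ • z ∈ K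

/-- The permutation representation of `Sₙ` on `ℂⁿ`: `(P σ v)ᵢ = v_{σ⁻¹ i}` (so `P σ e_j = e_{σ j}`
and `P` is a homomorphism). [cite: MageeNaudPuder2022, §1.1] -/
def permAct {n : ℕ} (σ : Equiv.Perm (Fin n)) (v : Fin n → ℂ) : Fin n → ℂ :=
  fun i => v (σ.symm i)

/-- **The hyperbolic Laplacian** `Δ F = −y² (∂²F/∂x² + ∂²F/∂y²)` of a vector-valued function on
`ℂ` at `z = x + iy` (second derivatives along `1` and `i` as Mathlib's second Fréchet derivative
over `ℝ`); used only at points of the open upper half-plane. [cite: MageeNaudPuder2022, §1.1] -/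
def hyperbolicLaplacian {F : Type*} [NormedAddCommGroup F] [NormedSpace ℝ F] (f : ℂ → F) (z : ℂ) : F :=
  -(z.im ^ 2) • (iteratedFDeriv ℝ 2 f z ![1, 1] + iteratedFDeriv ℝ 2 f z ![Complex.I, Complex.I])

/-- **New eigenfunctions of the cover `X_φ`.**  For `φ : Γ →* Sₙ` (the monodromy of a degree-`n`
cover of `Γ\ℍ` with labelled fibre) and `λ ∈ ℝ`: there is a `C²` function `F : ℍ → ℂⁿ`
(a function on `ℂ`, twice continuously differentiable on `{Im z > 0}`), not identically zero on
`ℍ`, which is `φ`-equivariant (`F(γ z) = P(φ γ) F(z)` — a function on `X_φ = Γ\(ℍ × [n])`), takes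
values in `V⁰ = {v | ∑ᵢ vᵢ = 0}` (orthogonal to the pull-backs from `Γ\ℍ`, fibrewise), and
satisfies `Δ F = λ F` on `ℍ`.  Its existence says exactly that `λ` is a NEW eigenvalue of `X_φ`
("appears with greater multiplicity in `X_φ`" than in `X`). [cite: MageeNaudPuder2022, §1.1] -/
def HasNewEigenfunction (Γ : Subgroup SL(2, ℝ)) {n : ℕ} (φ : Γ →* Equiv.Perm (Fin n)) (lam : ℝ) : Prop :=
  ∃ F : ℂ → (Fin n → ℂ),
    ContDiffOn ℝ 2 F {z : ℂ | 0 < z.im} ∧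
      (∃ z : ℍ, F z ≠ 0) ∧
        (∀ γ : Γ, ∀ z : ℍ, F ((γ • z : ℍ) : ℂ) = permAct (φ γ) (F z)) ∧
          (∀ z : ℍ, ∑ i, F z i = 0) ∧
            ∀ z : ℍ, hyperbolicLaplacian F z = lam • F z

/-- The proportion of homomorphisms `φ : Γ →* Sₙ` (uniform probability on the finite set
`Hom(Γ, Sₙ)`) satisfying a property. [cite: MageeNaudPuder2022, §1.1] -/
def homProportion (Γ : Subgroup SL(2, ℝ)) (n : ℕ) (good : (Γ →* Equiv.Perm (Fin n)) → Prop) : ℝ :=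
  (Nat.card {φ : Γ →* Equiv.Perm (Fin n) // good φ} : ℝ) / Nat.card (Γ →* Equiv.Perm (Fin n))

/-! ### The fact -/

/-- **Magee–Naud–Puder 2022, Theorem 1.5 (relative spectral gap `3/16 − ε` for random covers).**
"Let `X` be a compact connected hyperbolic surface. Then for any `ε > 0`, a.a.s.
`spec(Δ_{X_φ}) ∩ [0, 3/16 − ε] = spec(Δ_X) ∩ [0, 3/16 − ε]` and the multiplicities on both sides
are the same" — where `φ` is uniform on `Hom(π₁ X, Sₙ)`, `X_φ` is the associated degree-`n` cover,
and a.a.s. means with probability tending to `1` as `n → ∞`.  Typed in the uniformised model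
(`IsCompactHyperbolicSurfaceGroup`, `HasNewEigenfunction`): for every `ε > 0` the proportion of
`φ : Γ →* Sₙ` whose cover has NO new eigenvalue in `[0, 3/16 − ε]` tends to `1`.
[cite: MageeNaudPuder2022, Thm. 1.5] -/
def MageeNaudPuder2022_relativeSpectralGap : Prop :=
  ∀ Γ : Subgroup SL(2, ℝ), IsCompactHyperbolicSurfaceGroup Γ →
    ∀ ε : ℝ, 0 < ε →
      Tendsto (fun n : ℕ => homProportion Γ n fun φ =>
          ¬ ∃ lam ∈ Set.Icc (0 : ℝ) (3 / 16 - ε), HasNewEigenfunction Γ φ lam)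
        atTop (𝓝 1)

/-! ### API -/

/-- The permutation representation is a left action: `P 1 = id`. [folklore] -/
@[simp] theorem permAct_one {n : ℕ} (v : Fin n → ℂ) : permAct (1 : Equiv.Perm (Fin n)) v = v := rfl

/-- The permutation representation is a left action: `P (σ τ) = P σ ∘ P τ`. [folklore] -/
theorem permAct_mul {n : ℕ} (σ τ : Equiv.Perm (Fin n)) (v : Fin n → ℂ) :
    permAct (σ * τ) v = permAct σ (permAct τ v) := rfl

/-- `P σ` preserves `V⁰ = {∑ᵢ vᵢ = 0}` (it permutes the summands). [folklore] -/
theorem sum_permAct {n : ℕ} (σ : Equiv.Perm (Fin n)) (v : Fin n → ℂ) : ∑ i, permAct σ v i = ∑ i, v i :=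
  Equiv.sum_comp σ.symm v

/-- The hyperbolic Laplacian kills constants. [folklore] -/
theorem hyperbolicLaplacian_const {F : Type*} [NormedAddCommGroup F] [NormedSpace ℝ F] (c : F) (z : ℂ) :
    hyperbolicLaplacian (fun _ : ℂ => c) z = 0 := by
  simp [hyperbolicLaplacian, iteratedFDeriv_const_of_ne (𝕜 := ℝ) (E := ℂ) two_ne_zero c]

/-- A new eigenfunction for the trivial cover (`n = 1`) does not exist: on `ℂ¹` the condition
`∑ᵢ Fᵢ = 0` forces `F = 0` on `ℍ`.  (Degree-one covers have no new eigenvalues.) [folklore] -/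
theorem not_hasNewEigenfunction_one (Γ : Subgroup SL(2, ℝ)) (φ : Γ →* Equiv.Perm (Fin 1)) (lam : ℝ) :
    ¬ HasNewEigenfunction Γ φ lam := by
  rintro ⟨F, -, ⟨z, hz⟩, -, hsum, -⟩
  apply hz
  funext i
  have h := hsum z
  rw [Fin.sum_univ_one] at h
  rw [Subsingleton.elim i 0, h]
  rfl

/-- Unfolding lemma. [cite: MageeNaudPuder2022, Thm. 1.5] -/
theorem mageeNaudPuder2022_relativeSpectralGap_iff :
    MageeNaudPuder2022_relativeSpectralGap ↔
      ∀ Γ : Subgroup SL(2, ℝ), IsCompactHyperbolicSurfaceGroup Γ → ∀ ε : ℝ, 0 < ε →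
        Tendsto (fun n : ℕ => homProportion Γ n fun φ =>
            ¬ ∃ lam ∈ Set.Icc (0 : ℝ) (3 / 16 - ε), HasNewEigenfunction Γ φ lam) atTop (𝓝 1) :=
  Iff.rfl

end Literature.Geometry.Riemannian
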